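import Summits.KontsevichZagierPeriods.KontsevichZagierPeriods.Theses.HurwitzMicroSectors
import Summits.KontsevichZagierPeriods.KontsevichZagierPeriods.Theorems.HurwitzMicroSectorsNormalFormPrinciplePiBoxTransfer

/-! TTRL-lite variant V2242 of stmt-KontsevichZagierPeriods-3869

Variant V2242 = `stub_boxRigidity` (the leaf `BoxRigidity` of `NormalFormPrinciple`: two box-rational
representations — domain the open unit box, integrand `p/q` over `ℚ` — with equal values are
KZ-equivalent) with BOTH dimensions frozen to `3`, move `fix_nat:m=3; fix_nat:m'=3`. Verdict of the
attempt seat: **open** — this file is the exact-strength certificate, not a proof of the variant.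
A joint freeze is a genuine weakening of the leaf (the one-sided freezes `fix m` / `fix m'` are the whole
leaf again, `boxRigidityLeft_iff` / `boxRigidityRight_iff`, file `…Variants2200`), and it pins the leaf to
ONE dimension: V2242 is EQUIVALENT to **BoxVanishing in dimension `3`** — every box-rational
representation on `(0,1)³` of value `0` is a relation (`stub_boxRigidity_var2242_iff_boxVanishing_three`:
`⇒` compare with the zero representation on the `3`-box, itself box-rational of value `0` and a relation;
`⇐` subtract on the common box, `sub_same`, value `0` by soundness — no padding needed). Hence V2242 is
literally equivalent to the sibling variants V2349/V2350/V2239 (same right-hand side BoxVanishing(3),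
files `…Variants2349/2350/2239`), to BoxRigidity with both dimensions `≤ 3`
(`stub_boxRigidity_var2242_iff_boxRigidityLe_three`: pad by unit intervals, `pad_le`) and to
BoxVanishing in all dimensions `≤ 3` (`stub_boxRigidity_var2242_iff_boxVanishingLe_three`): Conjecture 1
of Kontsevich–Zagier for all pairs of rational integrands on the boxes `(0,1)^{≤3}`. That fragment
contains, unconditionally, Conjecture 1 on the level-`4` weight-`2` box sector
(`sectorTwoFour_of_stub_boxRigidity_var2349` composed with the equivalence), which the tree proves only
under the OPEN hypothesis `LinearIndependent ℚ ![1, π², G]` (`CatalanSectorTwoFour`,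
stmt-KontsevichZagierPeriods-3877), and the pair `[1/(1−xyz)]` (value `ζ(3)`) versus `[a + b/(1−xy)]`
(value `a + bπ²/6`, `a b : ℚ`), whose case split is the open question `ζ(3) ∈ ℚ + ℚπ²`. It is implied by
the Summit (`stub_boxRigidity_var2242_of_statement`), so a refutation of the variant would refute
Conjecture 1 for the tree's calculus. The proved two-sided instance is `m, m' ≤ 1`
(`boxRigidity_of_le_one`, Baker); dimension `3` already carries weight-two and weight-three arithmetic.
Source: M. Kontsevich, D. Zagier, *Periods* (2001), §1.2 Conjecture 1. Pure proof file, no definitions. -/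

-- `Summit.<Summit>.<Problem>` is the tree's mandated summit-side namespace (CONVENTIONS §2); for this
-- single-conjunct summit the two coincide, so the duplicate is deliberate.
set_option linter.dupNamespace false

noncomputable section

namespace Summit.KontsevichZagierPeriods.KontsevichZagierPeriods.Theorems

open MeasureTheory Set
open Literature.NumberTheory.Transcendental Literature.NumberTheory.Transcendental.KZ
open Summit.KontsevichZagierPeriods.KontsevichZagierPeriods.Theses.HurwitzMicroSectors
open Summit.KontsevichZagierPeriods.HurwitzMicroSectors.NormalFormPrinciple.PiBox
open Summit.KontsevichZagierPeriods.HurwitzMicroSectors.NormalFormPrinciple.PiBox.stub_boxCombineAux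

/-! ## V2242 ⇒ BoxVanishing in dimension 3 -/

/-- **V2242 ⇒ BoxVanishing in dimension `3`**: compare a box-rational `N : IntegralRep 3` of value `0`
with the zero representation on the `3`-box (box-rational, value `0`, itself a relation).
[cite: KontsevichZagier2001, §1.2 Conjecture 1] -/
theorem boxVanishing_three_of_stub_boxRigidity_var2242
    (h : ∀ (N : IntegralRep 3) (N' : IntegralRep 3), N.domain = {x | ∀ i, x i ∈ Set.Ioo (0:ℝ) 1} → N.IsRational → N'.domain = {x | ∀ i, x i ∈ Set.Ioo (0:ℝ) 1} → N'.IsRational → N.value = N'.value → Equivalent N N')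
    (N : IntegralRep 3) (hNd : N.domain = {x | ∀ i, x i ∈ Set.Ioo (0:ℝ) 1}) (hNr : N.IsRational)
    (hv : N.value = 0) : of N ∈ relations := by
  obtain ⟨Z, hZd, hZi⟩ := exists_zeroRep (isSemialgebraic_box 3)
  have hZ : of Z ∈ relations := of_mem_relations_of_eqOn_zero Z (by simp [hZi, EqOn])
  have hZv : Z.value = 0 := by simp [IntegralRep.value, hZi]
  have hZr : Z.IsRational := ⟨0, 1, fun x _ => by simp, fun x _ => by simp [hZi]⟩
  have h' : of Z - of N ∈ relations := h Z N hZd hZr hNd hNr (by rw [hv, hZv])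
  have := relations.sub_mem hZ h'
  rwa [sub_sub_cancel] at this

/-! ## BoxVanishing in dimension 3 ⇒ V2242, and V2242 ⇒ BoxRigidity with both dimensions ≤ 3 -/

/-- **BoxVanishing in dimension `3` ⇒ V2242**: subtract the integrands on the common `3`-box
(`sub_same`, rule 1b)); the difference is box-rational of value `0` by soundness, hence a relation.
No padding is needed since both dimensions are `3`. [cite: KontsevichZagier2001, §1.2 Conjecture 1] -/
theorem stub_boxRigidity_var2242_of_boxVanishing_three
    (hvan : ∀ (M : IntegralRep 3), M.domain = {x | ∀ i, x i ∈ Set.Ioo (0:ℝ) 1} → M.IsRational →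
      M.value = 0 → of M ∈ relations) :
    ∀ (N : IntegralRep 3) (N' : IntegralRep 3), N.domain = {x | ∀ i, x i ∈ Set.Ioo (0:ℝ) 1} → N.IsRational → N'.domain = {x | ∀ i, x i ∈ Set.Ioo (0:ℝ) 1} → N'.IsRational → N.value = N'.value → Equivalent N N' := by
  intro N N' hNd hNr hN'd hN'r hv
  obtain ⟨M, hMd, hMr, hM⟩ := sub_same N N' hNd hNr hN'd hN'r
  have hMv : M.value = 0 := by
    have e := relations_le_ker_eval_holds hM
    rw [AddMonoidHom.mem_ker, map_sub, map_sub, eval_of, eval_of, eval_of, hv, sub_self,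
      zero_sub, neg_eq_zero] at e
    exact e
  have := relations.add_mem hM (hvan M hMd hMr hMv)
  rwa [sub_add_cancel] at this

/-- **V2242 ⇒ BoxRigidity for `m, m' ≤ 3`**: pad both representations to the `3`-box by unit
intervals (`pad_le`: one Newton–Leibniz move and two null faces per interval); the padded
representations are box-rational on `(0,1)³` with the same values (soundness), so V2242 applies to
them. [cite: KontsevichZagier2001, §1.2 Conjecture 1] -/
theorem boxRigidityLe_three_of_stub_boxRigidity_var2242
    (h : ∀ (N : IntegralRep 3) (N' : IntegralRep 3), N.domain = {x | ∀ i, x i ∈ Set.Ioo (0:ℝ) 1} → N.IsRational → N'.domain = {x | ∀ i, x i ∈ Set.Ioo (0:ℝ) 1} → N'.IsRational → N.value = N'.value → Equivalent N N') :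
    ∀ (m m' : ℕ) (N : IntegralRep m) (N' : IntegralRep m'), m ≤ 3 → m' ≤ 3 →
      N.domain = {x | ∀ i, x i ∈ Set.Ioo (0:ℝ) 1} → N.IsRational →
      N'.domain = {x | ∀ i, x i ∈ Set.Ioo (0:ℝ) 1} → N'.IsRational →
      N.value = N'.value → Equivalent N N' := by
  intro m m' N N' hm hm' hNd hNr hN'd hN'r hv
  obtain ⟨R₁, h₁d, h₁r, h₁⟩ := pad_le hm N hNd hNr
  obtain ⟨R₂, h₂d, h₂r, h₂⟩ := pad_le hm' N' hN'd hN'r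
  have hv₁ : N.value = R₁.value := Equivalent.value_eq_holds h₁
  have hv₂ : N'.value = R₂.value := Equivalent.value_eq_holds h₂
  have h₁₂ : of R₁ - of R₂ ∈ relations := h R₁ R₂ h₁d h₁r h₂d h₂r (by rw [← hv₁, ← hv₂, hv])
  have e : of N - of N' = (of N - of R₁) + (of R₁ - of R₂) - (of N' - of R₂) := by abel
  show of N - of N' ∈ relations
  rw [e]
  exact relations.sub_mem (relations.add_mem h₁ h₁₂) h₂

/-! ## The variant V2242 itself -/

/-- **V2242 ⟺ BoxVanishing in dimension `3`** — verbatim the right-hand side of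
`stub_boxRigidity_var2349_iff_boxVanishing_three` (file `…Variants2349`), so V2242 ⟺ V2349 by
`Iff.trans`. [cite: KontsevichZagier2001, §1.2 Conjecture 1] -/
theorem stub_boxRigidity_var2242_iff_boxVanishing_three :
    (∀ (N : IntegralRep 3) (N' : IntegralRep 3), N.domain = {x | ∀ i, x i ∈ Set.Ioo (0:ℝ) 1} → N.IsRational → N'.domain = {x | ∀ i, x i ∈ Set.Ioo (0:ℝ) 1} → N'.IsRational → N.value = N'.value → Equivalent N N') ↔
    (∀ (M : IntegralRep 3), M.domain = {x | ∀ i, x i ∈ Set.Ioo (0:ℝ) 1} → M.IsRational →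
      M.value = 0 → of M ∈ relations) :=
  ⟨boxVanishing_three_of_stub_boxRigidity_var2242, stub_boxRigidity_var2242_of_boxVanishing_three⟩

/-- **V2242 ⟺ BoxRigidity with both dimensions `≤ 3`** (the honest strength of the variant: Conjecture 1
for all pairs of rational integrands on the open unit boxes of dimension at most `3`).
[cite: KontsevichZagier2001, §1.2 Conjecture 1] -/
theorem stub_boxRigidity_var2242_iff_boxRigidityLe_three :
    (∀ (N : IntegralRep 3) (N' : IntegralRep 3), N.domain = {x | ∀ i, x i ∈ Set.Ioo (0:ℝ) 1} → N.IsRational → N'.domain = {x | ∀ i, x i ∈ Set.Ioo (0:ℝ) 1} → N'.IsRational → N.value = N'.value → Equivalent N N') ↔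
    (∀ (m m' : ℕ) (N : IntegralRep m) (N' : IntegralRep m'), m ≤ 3 → m' ≤ 3 →
      N.domain = {x | ∀ i, x i ∈ Set.Ioo (0:ℝ) 1} → N.IsRational →
      N'.domain = {x | ∀ i, x i ∈ Set.Ioo (0:ℝ) 1} → N'.IsRational →
      N.value = N'.value → Equivalent N N') :=
  ⟨boxRigidityLe_three_of_stub_boxRigidity_var2242, fun h N N' => h 3 3 N N' le_rfl le_rfl⟩

/-- **V2242 ⟺ BoxVanishing in ALL dimensions `≤ 3`** (so V2242 also settles the square and the
interval: pad to the `3`-box). [cite: KontsevichZagier2001, §1.2 Conjecture 1] -/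
theorem stub_boxRigidity_var2242_iff_boxVanishingLe_three :
    (∀ (N : IntegralRep 3) (N' : IntegralRep 3), N.domain = {x | ∀ i, x i ∈ Set.Ioo (0:ℝ) 1} → N.IsRational → N'.domain = {x | ∀ i, x i ∈ Set.Ioo (0:ℝ) 1} → N'.IsRational → N.value = N'.value → Equivalent N N') ↔
    (∀ (m : ℕ) (M : IntegralRep m), m ≤ 3 → M.domain = {x | ∀ i, x i ∈ Set.Ioo (0:ℝ) 1} →
      M.IsRational → M.value = 0 → of M ∈ relations) := by
  refine ⟨fun h m M hm hMd hMr hv => ?_, fun hvan =>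
    stub_boxRigidity_var2242_of_boxVanishing_three fun M => hvan 3 M le_rfl⟩
  obtain ⟨R, hRd, hRr, hR⟩ := pad_le hm M hMd hMr
  have hRv : R.value = 0 := (Equivalent.value_eq_holds hR).symm.trans hv
  have := relations.add_mem hR (boxVanishing_three_of_stub_boxRigidity_var2242 h R hRd hRr hRv)
  rwa [sub_add_cancel] at this

/-- **The parent leaf ⇒ V2242** (specialisation `m = m' = 3`). [cite: KontsevichZagier2001, §1.2 Conjecture 1] -/
theorem stub_boxRigidity_var2242_of_parent
    (h : ∀ (m m' : ℕ) (N : IntegralRep m) (N' : IntegralRep m'), N.domain = {x | ∀ i, x i ∈ Set.Ioo (0:ℝ) 1} → N.IsRational → N'.domain = {x | ∀ i, x i ∈ Set.Ioo (0:ℝ) 1} → N'.IsRational → N.value = N'.value → Equivalent N N') :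
    ∀ (N : IntegralRep 3) (N' : IntegralRep 3), N.domain = {x | ∀ i, x i ∈ Set.Ioo (0:ℝ) 1} → N.IsRational → N'.domain = {x | ∀ i, x i ∈ Set.Ioo (0:ℝ) 1} → N'.IsRational → N.value = N'.value → Equivalent N N' :=
  h 3 3

/-- **`KontsevichZagierPeriods ⇒ V2242`**: the variant is a special case of Conjecture 1 for the tree's
calculus — a refutation of the variant would refute the Summit. [cite: KontsevichZagier2001, §1.2 Conjecture 1] -/
theorem stub_boxRigidity_var2242_of_statement (h : _root_.KontsevichZagierPeriods) :
    ∀ (N : IntegralRep 3) (N' : IntegralRep 3), N.domain = {x | ∀ i, x i ∈ Set.Ioo (0:ℝ) 1} → N.IsRational → N'.domain = {x | ∀ i, x i ∈ Set.Ioo (0:ℝ) 1} → N'.IsRational → N.value = N'.value → Equivalent N N' :=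
  stub_boxRigidity_var2242_of_parent (leaves_of_statement h).1

end Summit.KontsevichZagierPeriods.KontsevichZagierPeriods.Theorems
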